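import Summits.AnomalousDissipation.AnomalousDissipation.Theorems.SawtoothPulseCascadeK1LocalisedCascadePhaseWindowsCTE
import Summits.AnomalousDissipation.AnomalousDissipation.Theorems.SawtoothPulseCascadeK1LocalisedCascadeLedgerFeedChain

/-!
# K1loc — ONE RESOLVED PHASE OF THE FIBRE LEDGER IN CTE-GEOM GRADE, SYMBOLIC THRESHOLDS AND CAPS (composition; `PhaseStep3CTE`)

Prover lane on the crux `K1LocalisedCascade` (stmt-AnomalousDissipation-19491), route `SawtoothPulseCascade` (S-D seat; arbiter
A24-6: «PhaseStep3CTE = `phase_step_of_dischargers` with (E₃, o₃, 𝔞₃) symbolic»).  `…LedgerFeedChain.strip_offCone_resolved_step`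
instantiated with the four CTE-Geom windows of `…PhaseWindowsCTE` at thresholds `K → K′ → K″`, feed threshold `Y`, `M_b` blocks:
  `S_{j+1}(K″) + O_{j+1}(K″) ≤ S_j(K) + O_j(K) + e_j`,
  `e_j = w_T² + 2w_T·o + (w_S + w_C + 𝔞 + √f_C)² + (w_O + w_C + 𝔞 + √f_C)² + f_S + f_T + f_O`,
with the shell amplitude `√A_j(Y) ≤ 𝔞` and the off-cone amplitude `√O_j(K) ≤ o` as hypotheses (the feed class `C_j(Y)` is charged
in both the S- and the O-discharger, each through its own copy of the (C-H) window; at phase 3 of the K1loc′ chain of record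
`K = K₃`, `K″ = K₄ = 5·10⁵`, `E₃ = S₃(K₃) + O₃(K₃)`, and `o = o₃`, `𝔞 = 𝔞₃` are ad-k1loc-p3's certificates).
No definitions; no statement about the crux. [cite: Grafakos2014, Prop. 3.1.2 (5), Prop. 3.2.7 (3), §3.1.3] [problem: turb]
-/

-- `Summit.<Summit>.<Problem>`: single-conjunct summit, the duplicate namespace segment is deliberate.
set_option linter.dupNamespace false

noncomputable section

namespace Summit.AnomalousDissipation.AnomalousDissipation.Theorems.SawtoothPulseCascade.K1Window

open MeasureTheory Set Filter Topology UnitAddTorus Function Complex Metric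
open scoped Real ENNReal
open Literature.Analysis Literature.Analysis.FunctionSpaces Literature.Analysis.FunctionSpaces.Torus Literature.Analysis.FluidPDE
open Literature.Analysis.FluidPDE.ShearStage
open Literature.Analysis.FluidPDE.SawtoothCascade Literature.Analysis.FluidPDE.SawtoothCascade.CascadeParams
open Summit.AnomalousDissipation.AnomalousDissipation.Theorems.SawtoothPulseCascade.K1Start
open Summit.AnomalousDissipation.AnomalousDissipation.Theorems.SawtoothPulseCascade.K1Flat
open Summit.AnomalousDissipation.AnomalousDissipation.Theorems.SawtoothPulseCascade.K1Ledger.From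

section Cascade

variable (P : CascadeParams)

/-- **ONE PHASE AT WINDOWS `K → K′ → K″` WITH FEED THRESHOLD `Y`, CTE-GEOM GRADE** (composition of the four windows by
`…LedgerFeedChain.strip_offCone_resolved_step`; the shell amplitude `√A_j(Y) ≤ 𝔞` and the off-cone amplitude `√O_j(K) ≤ o` are
supplied by the caller — at phase 3 these are ad-k1loc-p3's certificates `𝔞₃`, `o₃`, and `S_j(K) + O_j(K)` is `E₃`):
`S_{j+1}(K″) + O_{j+1}(K″) ≤ S_j(K) + O_j(K) + e_j`, `e_j = w_T² + 2w_T·o + (w_S + w_C + 𝔞 + √f_C)² + (w_O + w_C + 𝔞 + √f_C)² + f_S + f_T + f_O`.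
[cite: Grafakos2014, Prop. 3.1.2 (5), Prop. 3.2.7 (3), §3.1.3] -/
theorem resolved_step_cte (hγ : P.γ = 8) (hδ₀ : 0 < P.δ₀) (hd : P.d = 2) (hN₀ : P.N₀ = 1) (hρN : P.ρN = 2)
    (a b : ℕ → UnitAddTorus (Fin 2) → ℝ) (has : ∀ j, IsSmooth (a j)) (h0 : a 0 = datum)
    (hb : ∀ j, b j = a j ∘ shearMap 0 1 (amp ⟨P.U j, P.U_periodic j, P.contDiff_U (P.δ_pos hδ₀ (by rw [hd]; norm_num) j)⟩ P.γ))
    (hab : ∀ j, a (j + 1) = b j ∘ shearMap 1 0 (amp ⟨P.U j, P.U_periodic j, P.contDiff_U (P.δ_pos hδ₀ (by rw [hd]; norm_num) j)⟩ P.γ))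
    (j : ℕ) {K K' K'' Y : ℕ} (hK : 107 ≤ K) (hK' : 264 ≤ K')
    (hKK' : 64 * K' < 485 * (K - 1)) (hK'' : 1060 ≤ K'') (hK'K'' : 64 * K'' < 485 * (K' - 1)) (hY : 150 ≤ Y)
    (hYS : Y ≤ K' / 3 + 1) (hYO : Y ≤ K'' / 4 / 3 + 1) (Mb : ℕ) (hMδ : 10 * P.δ j < π / 2) {𝔞 o : ℝ}
    (h𝔞 : Real.sqrt (∑' k : Fin 2 → ℤ, (if (Y : ℤ) ≤ |k 0| ∧ (((1 : ℕ)) : ℤ) * |k 0| ≤ (((2 : ℕ)) : ℤ) * |k 1| then (1 : ℝ) else 0) * ‖mFourierCoeff (fun x => (a j x : ℂ)) k‖ ^ 2) ≤ 𝔞)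
    (ho : Real.sqrt (∑' k : Fin 2 → ℤ, (if (K : ℤ) ≤ |k 0| ∧ (((1 : ℕ)) : ℤ) * |k 0| ≤ (((4 : ℕ)) : ℤ) * |k 1| then (1 : ℝ) else 0) * ‖mFourierCoeff (fun x => (a j x : ℂ)) k‖ ^ 2) ≤ o) :
    ∑' k : Fin 2 → ℤ, (if |k 0| < (K'' : ℤ) then (1 : ℝ) else 0) * ‖mFourierCoeff (fun x => (a (j + 1) x : ℂ)) k‖ ^ 2 +
      ∑' k : Fin 2 → ℤ, (if (K'' : ℤ) ≤ |k 0| ∧ (((1 : ℕ)) : ℤ) * |k 0| ≤ (((4 : ℕ)) : ℤ) * |k 1| then (1 : ℝ) else 0) * ‖mFourierCoeff (fun x => (a (j + 1) x : ℂ)) k‖ ^ 2 ≤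
      ∑' k : Fin 2 → ℤ, (if |k 0| < (K : ℤ) then (1 : ℝ) else 0) * ‖mFourierCoeff (fun x => (a j x : ℂ)) k‖ ^ 2 +
      ∑' k : Fin 2 → ℤ, (if (K : ℤ) ≤ |k 0| ∧ (((1 : ℕ)) : ℤ) * |k 0| ≤ (((4 : ℕ)) : ℤ) * |k 1| then (1 : ℝ) else 0) * ‖mFourierCoeff (fun x => (a j x : ℂ)) k‖ ^ 2 +
      ((Real.sqrt (6 * (P.N j : ℝ) ^ 2 * (((((16 : ℕ)) : ℝ) + ((11 : ℕ))) / ((((16 : ℕ)) : ℝ) - ((11 : ℕ)))) *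
              (((((9 : ℕ)) : ℝ) / ((8 : ℕ))) ^ 2 / ((((((9 : ℕ)) : ℝ) / ((8 : ℕ))) ^ 2 - 1) * ((((8 : ℕ) : ℝ)) * ((K : ℝ) - 1) - K') ^ 2) +
                ((((9 : ℕ)) : ℝ) / ((8 : ℕ))) / ((((((9 : ℕ)) : ℝ) / ((8 : ℕ))) - 1) * (P.N j * ((((8 : ℕ) : ℝ)) * ((K : ℝ) - 1) - K')))) / π ^ 2 +
            12 * (P.N j : ℝ) ^ 2 * ((((27 : ℕ) : ℝ)) * K / ((((((8 : ℕ) : ℝ)) * ((64 : ℕ)) - ((27 : ℕ))) * ((K : ℝ) - 1) - K' * ((64 : ℕ))))) ^ 2 *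
              (2 * ((((27 : ℕ) : ℝ)) * K / ((64 : ℕ))) / (P.N j * ((((8 : ℕ) : ℝ)) * ((K : ℝ) - 1) - K') ^ 2) + 2 * ((((27 : ℕ) : ℝ)) * K / ((64 : ℕ))) / ((P.N j : ℝ) ^ 2 * ((((8 : ℕ) : ℝ)) * ((K : ℝ) - 1) - K')) +
                1 / ((((8 : ℕ) : ℝ)) * ((K : ℝ) - 1) - K') ^ 2 + 1 / (P.N j * ((((8 : ℕ) : ℝ)) * ((K : ℝ) - 1) - K'))) / π ^ 2 / 2) +
          Real.sqrt ((π * ((K : ℝ) * ((8 : ℕ))) * ((((9 : ℕ)) : ℝ) / ((8 : ℕ))) ^ Mb * ((2 : ℝ)⁻¹ ^ 70) / P.N j) ^ 2 / 2 +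
            Mb * (8 * (10 : ℝ) * P.δ j / π * (((((16 : ℕ)) : ℝ) + ((11 : ℕ))) / ((((16 : ℕ)) : ℝ) - ((11 : ℕ))))))) ^ 2 + 2 * (Real.sqrt (6 * (P.N j : ℝ) ^ 2 * (((((16 : ℕ)) : ℝ) + ((11 : ℕ))) / ((((16 : ℕ)) : ℝ) - ((11 : ℕ)))) *
              (((((9 : ℕ)) : ℝ) / ((8 : ℕ))) ^ 2 / ((((((9 : ℕ)) : ℝ) / ((8 : ℕ))) ^ 2 - 1) * ((((8 : ℕ) : ℝ)) * ((K : ℝ) - 1) - K') ^ 2) +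
                ((((9 : ℕ)) : ℝ) / ((8 : ℕ))) / ((((((9 : ℕ)) : ℝ) / ((8 : ℕ))) - 1) * (P.N j * ((((8 : ℕ) : ℝ)) * ((K : ℝ) - 1) - K')))) / π ^ 2 +
            12 * (P.N j : ℝ) ^ 2 * ((((27 : ℕ) : ℝ)) * K / ((((((8 : ℕ) : ℝ)) * ((64 : ℕ)) - ((27 : ℕ))) * ((K : ℝ) - 1) - K' * ((64 : ℕ))))) ^ 2 *
              (2 * ((((27 : ℕ) : ℝ)) * K / ((64 : ℕ))) / (P.N j * ((((8 : ℕ) : ℝ)) * ((K : ℝ) - 1) - K') ^ 2) + 2 * ((((27 : ℕ) : ℝ)) * K / ((64 : ℕ))) / ((P.N j : ℝ) ^ 2 * ((((8 : ℕ) : ℝ)) * ((K : ℝ) - 1) - K')) +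
                1 / ((((8 : ℕ) : ℝ)) * ((K : ℝ) - 1) - K') ^ 2 + 1 / (P.N j * ((((8 : ℕ) : ℝ)) * ((K : ℝ) - 1) - K'))) / π ^ 2 / 2) +
          Real.sqrt ((π * ((K : ℝ) * ((8 : ℕ))) * ((((9 : ℕ)) : ℝ) / ((8 : ℕ))) ^ Mb * ((2 : ℝ)⁻¹ ^ 70) / P.N j) ^ 2 / 2 +
            Mb * (8 * (10 : ℝ) * P.δ j / π * (((((16 : ℕ)) : ℝ) + ((11 : ℕ))) / ((((16 : ℕ)) : ℝ) - ((11 : ℕ))))))) * o +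
        ((Real.sqrt (6 * (P.N j : ℝ) ^ 2 * (((((10 : ℕ)) : ℝ) + ((9 : ℕ))) / ((((10 : ℕ)) : ℝ) - ((9 : ℕ)))) *
              (((((9 : ℕ)) : ℝ) / ((8 : ℕ))) ^ 2 / ((((((9 : ℕ)) : ℝ) / ((8 : ℕ))) ^ 2 - 1) * ((((8 : ℕ) : ℝ)) * ((K' : ℝ) - 1) - K'') ^ 2) +
                ((((9 : ℕ)) : ℝ) / ((8 : ℕ))) / ((((((9 : ℕ)) : ℝ) / ((8 : ℕ))) - 1) * (P.N j * ((((8 : ℕ) : ℝ)) * ((K' : ℝ) - 1) - K'')))) / π ^ 2 +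
            12 * (P.N j : ℝ) ^ 2 * ((((27 : ℕ) : ℝ)) * K' / ((((((8 : ℕ) : ℝ)) * ((64 : ℕ)) - ((27 : ℕ))) * ((K' : ℝ) - 1) - K'' * ((64 : ℕ))))) ^ 2 *
              (2 * ((((27 : ℕ) : ℝ)) * K' / ((64 : ℕ))) / (P.N j * ((((8 : ℕ) : ℝ)) * ((K' : ℝ) - 1) - K'') ^ 2) + 2 * ((((27 : ℕ) : ℝ)) * K' / ((64 : ℕ))) / ((P.N j : ℝ) ^ 2 * ((((8 : ℕ) : ℝ)) * ((K' : ℝ) - 1) - K'')) +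
                1 / ((((8 : ℕ) : ℝ)) * ((K' : ℝ) - 1) - K'') ^ 2 + 1 / (P.N j * ((((8 : ℕ) : ℝ)) * ((K' : ℝ) - 1) - K''))) / π ^ 2 / 2) +
          Real.sqrt ((π * ((K' : ℝ) * ((8 : ℕ))) * ((((9 : ℕ)) : ℝ) / ((8 : ℕ))) ^ Mb * ((2 : ℝ)⁻¹ ^ 70) / P.N j) ^ 2 / 2 +
            Mb * (8 * (10 : ℝ) * P.δ j / π * (((((10 : ℕ)) : ℝ) + ((9 : ℕ))) / ((((10 : ℕ)) : ℝ) - ((9 : ℕ))))))) + (Real.sqrt (6 * (P.N j : ℝ) ^ 2 * (((((16 : ℕ)) : ℝ) + ((13 : ℕ))) / ((((16 : ℕ)) : ℝ) - ((13 : ℕ)))) *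
              (((((9 : ℕ)) : ℝ) / ((8 : ℕ))) ^ 2 / ((((((9 : ℕ)) : ℝ) / ((8 : ℕ))) ^ 2 - 1) * (((((1 : ℕ)) : ℝ) * ((8 : ℕ)) - ((3 : ℕ))) * ((Y : ℝ) - 1) / ((1 : ℕ))) ^ 2) +
                ((((9 : ℕ)) : ℝ) / ((8 : ℕ))) / ((((((9 : ℕ)) : ℝ) / ((8 : ℕ))) - 1) * (P.N j * (((((1 : ℕ)) : ℝ) * ((8 : ℕ)) - ((3 : ℕ))) * ((Y : ℝ) - 1) / ((1 : ℕ)))))) / π ^ 2 +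
            12 * (P.N j : ℝ) ^ 2 * ((((1 : ℕ)) : ℝ) * ((45 : ℕ)) * Y / ((((((1 : ℕ)) : ℝ) * ((8 : ℕ)) - ((3 : ℕ))) * ((64 : ℕ)) - ((1 : ℕ)) * ((45 : ℕ))) * ((Y : ℝ) - 1))) ^ 2 *
              (2 * ((((45 : ℕ) : ℝ)) * Y / ((64 : ℕ))) / (P.N j * (((((1 : ℕ)) : ℝ) * ((8 : ℕ)) - ((3 : ℕ))) * ((Y : ℝ) - 1) / ((1 : ℕ))) ^ 2) + 2 * ((((45 : ℕ) : ℝ)) * Y / ((64 : ℕ))) / ((P.N j : ℝ) ^ 2 * (((((1 : ℕ)) : ℝ) * ((8 : ℕ)) - ((3 : ℕ))) * ((Y : ℝ) - 1) / ((1 : ℕ)))) +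
                1 / (((((1 : ℕ)) : ℝ) * ((8 : ℕ)) - ((3 : ℕ))) * ((Y : ℝ) - 1) / ((1 : ℕ))) ^ 2 + 1 / (P.N j * (((((1 : ℕ)) : ℝ) * ((8 : ℕ)) - ((3 : ℕ))) * ((Y : ℝ) - 1) / ((1 : ℕ))))) / π ^ 2 / 2) +
          Real.sqrt ((π * ((Y : ℝ) * ((8 : ℕ))) * ((((9 : ℕ)) : ℝ) / ((8 : ℕ))) ^ Mb * ((2 : ℝ)⁻¹ ^ 70) / P.N j) ^ 2 / 2 +
            Mb * (8 * (10 : ℝ) * P.δ j / π * (((((16 : ℕ)) : ℝ) + ((13 : ℕ))) / ((((16 : ℕ)) : ℝ) - ((13 : ℕ))))))) + 𝔞 + Real.sqrt (((1 + P.γ) ^ (2 * j) / ((Y * 9 ^ Mb / 8 ^ Mb : ℕ) : ℝ)) ^ 2)) ^ 2 +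
        ((Real.sqrt (6 * (P.N j : ℝ) ^ 2 * (((((10 : ℕ)) : ℝ) + ((9 : ℕ))) / ((((10 : ℕ)) : ℝ) - ((9 : ℕ)))) *
              (((((9 : ℕ)) : ℝ) / ((8 : ℕ))) ^ 2 / ((((((9 : ℕ)) : ℝ) / ((8 : ℕ))) ^ 2 - 1) * (((((1 : ℕ)) : ℝ) * ((8 : ℕ)) - ((4 : ℕ))) * ((((K'' / 4 : ℕ) : ℝ)) - 1) / ((1 : ℕ))) ^ 2) +
                ((((9 : ℕ)) : ℝ) / ((8 : ℕ))) / ((((((9 : ℕ)) : ℝ) / ((8 : ℕ))) - 1) * (P.N j * (((((1 : ℕ)) : ℝ) * ((8 : ℕ)) - ((4 : ℕ))) * ((((K'' / 4 : ℕ) : ℝ)) - 1) / ((1 : ℕ)))))) / π ^ 2 +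
            12 * (P.N j : ℝ) ^ 2 * ((((1 : ℕ)) : ℝ) * ((27 : ℕ)) * (K'' / 4 : ℕ) / ((((((1 : ℕ)) : ℝ) * ((8 : ℕ)) - ((4 : ℕ))) * ((64 : ℕ)) - ((1 : ℕ)) * ((27 : ℕ))) * ((((K'' / 4 : ℕ) : ℝ)) - 1))) ^ 2 *
              (2 * ((((27 : ℕ) : ℝ)) * (K'' / 4 : ℕ) / ((64 : ℕ))) / (P.N j * (((((1 : ℕ)) : ℝ) * ((8 : ℕ)) - ((4 : ℕ))) * ((((K'' / 4 : ℕ) : ℝ)) - 1) / ((1 : ℕ))) ^ 2) + 2 * ((((27 : ℕ) : ℝ)) * (K'' / 4 : ℕ) / ((64 : ℕ))) / ((P.N j : ℝ) ^ 2 * (((((1 : ℕ)) : ℝ) * ((8 : ℕ)) - ((4 : ℕ))) * ((((K'' / 4 : ℕ) : ℝ)) - 1) / ((1 : ℕ)))) +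
                1 / (((((1 : ℕ)) : ℝ) * ((8 : ℕ)) - ((4 : ℕ))) * ((((K'' / 4 : ℕ) : ℝ)) - 1) / ((1 : ℕ))) ^ 2 + 1 / (P.N j * (((((1 : ℕ)) : ℝ) * ((8 : ℕ)) - ((4 : ℕ))) * ((((K'' / 4 : ℕ) : ℝ)) - 1) / ((1 : ℕ))))) / π ^ 2 / 2) +
          Real.sqrt ((π * ((((K'' / 4 : ℕ) : ℝ)) * ((8 : ℕ))) * ((((9 : ℕ)) : ℝ) / ((8 : ℕ))) ^ Mb * ((2 : ℝ)⁻¹ ^ 70) / P.N j) ^ 2 / 2 +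
            Mb * (8 * (10 : ℝ) * P.δ j / π * (((((10 : ℕ)) : ℝ) + ((9 : ℕ))) / ((((10 : ℕ)) : ℝ) - ((9 : ℕ))))))) + (Real.sqrt (6 * (P.N j : ℝ) ^ 2 * (((((16 : ℕ)) : ℝ) + ((13 : ℕ))) / ((((16 : ℕ)) : ℝ) - ((13 : ℕ)))) *
              (((((9 : ℕ)) : ℝ) / ((8 : ℕ))) ^ 2 / ((((((9 : ℕ)) : ℝ) / ((8 : ℕ))) ^ 2 - 1) * (((((1 : ℕ)) : ℝ) * ((8 : ℕ)) - ((3 : ℕ))) * ((Y : ℝ) - 1) / ((1 : ℕ))) ^ 2) +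
                ((((9 : ℕ)) : ℝ) / ((8 : ℕ))) / ((((((9 : ℕ)) : ℝ) / ((8 : ℕ))) - 1) * (P.N j * (((((1 : ℕ)) : ℝ) * ((8 : ℕ)) - ((3 : ℕ))) * ((Y : ℝ) - 1) / ((1 : ℕ)))))) / π ^ 2 +
            12 * (P.N j : ℝ) ^ 2 * ((((1 : ℕ)) : ℝ) * ((45 : ℕ)) * Y / ((((((1 : ℕ)) : ℝ) * ((8 : ℕ)) - ((3 : ℕ))) * ((64 : ℕ)) - ((1 : ℕ)) * ((45 : ℕ))) * ((Y : ℝ) - 1))) ^ 2 *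
              (2 * ((((45 : ℕ) : ℝ)) * Y / ((64 : ℕ))) / (P.N j * (((((1 : ℕ)) : ℝ) * ((8 : ℕ)) - ((3 : ℕ))) * ((Y : ℝ) - 1) / ((1 : ℕ))) ^ 2) + 2 * ((((45 : ℕ) : ℝ)) * Y / ((64 : ℕ))) / ((P.N j : ℝ) ^ 2 * (((((1 : ℕ)) : ℝ) * ((8 : ℕ)) - ((3 : ℕ))) * ((Y : ℝ) - 1) / ((1 : ℕ)))) +
                1 / (((((1 : ℕ)) : ℝ) * ((8 : ℕ)) - ((3 : ℕ))) * ((Y : ℝ) - 1) / ((1 : ℕ))) ^ 2 + 1 / (P.N j * (((((1 : ℕ)) : ℝ) * ((8 : ℕ)) - ((3 : ℕ))) * ((Y : ℝ) - 1) / ((1 : ℕ))))) / π ^ 2 / 2) +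
          Real.sqrt ((π * ((Y : ℝ) * ((8 : ℕ))) * ((((9 : ℕ)) : ℝ) / ((8 : ℕ))) ^ Mb * ((2 : ℝ)⁻¹ ^ 70) / P.N j) ^ 2 / 2 +
            Mb * (8 * (10 : ℝ) * P.δ j / π * (((((16 : ℕ)) : ℝ) + ((13 : ℕ))) / ((((16 : ℕ)) : ℝ) - ((13 : ℕ))))))) + 𝔞 + Real.sqrt (((1 + P.γ) ^ (2 * j) / ((Y * 9 ^ Mb / 8 ^ Mb : ℕ) : ℝ)) ^ 2)) ^ 2 +
        ((1 + P.γ) ^ (2 * (j + 1)) / ((K' * 9 ^ Mb / 8 ^ Mb : ℕ) : ℝ)) ^ 2 + ((1 + P.γ) ^ (2 * j) / ((K * 9 ^ Mb / 8 ^ Mb : ℕ) : ℝ)) ^ 2 + ((1 + P.γ) ^ (2 * (j + 1)) / (((K'' / 4 : ℕ) * 9 ^ Mb / 8 ^ Mb : ℕ) : ℝ)) ^ 2) := by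
  have h1 := strip_vstep_cte_le P hγ hδ₀ hd hN₀ hρN a b has h0 hb hab j hK' hK'K'' hYS Mb hMδ
  have h2 := lowFibre_hstep_cte_le P hγ hδ₀ hd hN₀ hρN a b has h0 hb hab j hK hKK' Mb hMδ
  have h3 := offCone_vstep_cte_le P hγ hδ₀ hd hN₀ hρN a b has h0 hb hab j hK'' hYO Mb hMδ
  have h4 := subcone_hstep_cte_le P hγ hδ₀ hd hN₀ hρN a b has h0 hb hab j hY Mb hMδ
  have hI0 : ∀ (q : (Fin 2 → ℤ) → Prop) [DecidablePred q] (v : UnitAddTorus (Fin 2) → ℝ),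
      0 ≤ ∑' k : Fin 2 → ℤ, (if q k then (1 : ℝ) else 0) * ‖mFourierCoeff (fun x => (v x : ℂ)) k‖ ^ 2 :=
    fun q _ v => tsum_nonneg fun k => mul_nonneg (by split_ifs <;> norm_num) (sq_nonneg _)
  have hw : ∀ x y : ℝ, 0 ≤ Real.sqrt x + Real.sqrt y := fun x y => add_nonneg (Real.sqrt_nonneg _) (Real.sqrt_nonneg _)
  have h1' := h1.trans (add_assoc _ _ _).symm.le
  have h2' := h2.trans (add_assoc _ _ _).symm.le
  exact strip_offCone_resolved_step h1' h2' h3 h4 h4 h𝔞 h𝔞 ho (hI0 _ _) (hI0 _ _) (hI0 _ _) (hw _ _) (hw _ _) (hw _ _) (hw _ _)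
    (hw _ _) (sq_nonneg _) (sq_nonneg _)

end Cascade

end Summit.AnomalousDissipation.AnomalousDissipation.Theorems.SawtoothPulseCascade.K1Window
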